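import Mathlib.AlgebraicGeometry.Morphisms.Affine
import Literature.AlgebraicGeometry.Motives.AtypicalHodgeLocus
import Literature.AlgebraicGeometry.Motives.PeriodRealizationClassical
import HarnessLib

/-!
# Special subvarieties of a geometric variation of Hodge structure are countably many
# (Cattani–Deligne–Kaplan 1995; Baldi–Klingler–Ullmo 2024, §3.4)

Family `hodge`, layer `Literature/AlgebraicGeometry/Motives`, next to `AtypicalHodgeLocus` (home of
`VHSData.IsSpecialSubvariety`). ONE named fact and its first consequences.

**Source statement.** Baldi–Klingler–Ullmo, *On the distribution of the Hodge locus*, Invent. Math.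
235 (2024) (held text `paper:arxiv-2107.08838`), §3.4: "Any connected Hodge variety `Γ\D` is
naturally endowed with a countable collection of irreducible complex analytic subvarieties: its
special subvarieties `Γ_{G'}\D'` … (CDK) can be rephrased by saying that the preimage under `Φ` of any
special subvariety of `Γ\D` is an algebraic subvariety of `S`. … Definition 3.3. An irreducible
algebraic subvariety `Y ⊂ S` is called special … if it is an irreducible component of the
`Φ`-preimage of its special closure … The Hodge locus `HL(S, 𝕍^⊗)` is then the countable union of
the strict special subvarieties of `S` for `𝕍`", together with the intrinsic form "Lemma 3.6. The
special subvarieties of `S` for `𝕍` are the closed irreducible algebraic subvariety `Y ⊂ S` maximal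
among the closed irreducible algebraic subvarieties `Z` of `S` such that the generic Mumford–Tate
group `G_Z` of `Z` for `𝕍` equals `G_Y`" (here `S` is a smooth irreducible complex quasi-projective
variety and `𝕍` a polarizable `ℤ`VHS, e.g. `Rⁱf_*ℤ/torsion` of a smooth projective morphism
`f : X → S`, §1.1; the algebraicity input is Cattani–Deligne–Kaplan, JAMS 8 (1995), Thm. 1.1 /
Cor. 1.2). Consequently **a smooth irreducible complex quasi-projective variety carries only
countably many special subvarieties** for such a `𝕍`: each of the countably many special
subvarieties of `Γ\D` has an algebraic preimage with finitely many irreducible components.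

**Lean rendering** (`countable_specialSubvarieties_meeting_affineOpen`). The tree states BKU's
notions over the hypothesis structures of `Motives/FamiliesVHS` and `Motives/AtypicalHodgeLocus`:
a smooth projective family `f : 𝒳 ⟶ S` over `ℂ`, a geometric VHS datum
`D : GeometricVHSData B f n i` of `Rⁱf_*ℚ` relative to a CLASSICAL Betti–Hodge datum `B`
(`BettiHodgeData.IsClassical`: then `D.mtRankAt s = dim MT(Hⁱ(𝒳_s(ℂ); ℚ))` is the honest
Mumford–Tate rank of the fibre, `GeometricVHSData.mtRankAt_eq_mtRank_hodgeStructure` in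
`HodgeTheory/HodgeGenericRealCarrier`), and `D.IsSpecialSubvariety Y` = BKU Lemma 3.6 on complex
points (`Y ⊆ S(ℂ)` irreducible Zariski-closed and every strictly larger irreducible Zariski-closed
`Z` has a generic Mumford–Tate group of larger dimension). Two deliberate features:

* *Localised to an affine open.* The consumers (the `ℚ̄`-anchored Hodge routes, crux
  `PeriodDeficiency.QbarGenericIsHodgeGeneric`) carry NO quasi-compactness hypothesis on the base, and
  without it the global count is false for silly reasons: an affine line with uncountably many doubled
  origins is a smooth irreducible `ℂ`-scheme locally of finite type, and a family with a CM fibre over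
  the origins has uncountably many special points. The fact therefore counts the special subvarieties
  of `S` MEETING A GIVEN AFFINE OPEN `U ⊆ S` (`S` smooth irreducible, `U` affine, hence a smooth
  irreducible affine — in particular quasi-projective — variety). On paper this is the printed
  statement for `U`: a special `Y` meeting `U` is the Zariski closure of its trace `Y ∩ U(ℂ)`, and the
  trace is special for the restriction of the variation to `U` because generic Mumford–Tate groups of
  irreducible closed `Z ⊆ S(ℂ)` are attained on the dense open `Z ∩ U(ℂ)` (`MT(V_z) ⊆ G_Z` at every
  point of `Z`, with equality off a countable union of strict analytic subvarieties: André 1992 §5,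
  BKU §3.2). The global statement for quasi-compact `S` follows (`countable_specialSubvarieties_of`,
  proved here), as does countability of the special subvarieties through a point
  (`countable_specialSubvarieties_containing_of`, the form used by the crux).
* *A closed statement over hypothesis structures.* `GeometricVHSData` does not record the holomorphic
  variation of the Hodge filtration, but `IsSpecialSubvariety` reads only the pointwise ranks
  `D.mtRankAt` — pinned to the honest ranks by `hodge_F_eq` + `B.IsClassical` — and the Zariski
  topology of `S(ℂ)`; so the `∀ D` statement is the printed theorem for the Gauss–Manin variation of
  `f` and nothing more (same design as `HodgeTheory.bku_finite_monodromyOrbit_of_isHodgeGenericIn`).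

Discharging it needs the holomorphic period map, Cattani–Deligne–Kaplan (or definable Chow,
Bakker–Klingler–Tsimerman 2020 Thm. 1.6) and the structure of Mumford–Tate domains — none in the tree.

## References
* [BaldiKlinglerUllmo2024] G. Baldi, B. Klingler, E. Ullmo, Invent. Math. 235 (2024), §3.2, Def. 3.3,
  §3.4, Lemma 3.6.
* [CattaniDeligneKaplan1995JAMS] E. Cattani, P. Deligne, A. Kaplan, JAMS 8 (1995), Thm. 1.1, Cor. 1.2.
* [Andre1992] Y. André, Compositio Math. 82 (1992), §5 (generic Mumford–Tate group; `MT(V_s) ⊆ G`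
  everywhere, equality off a countable union of strict analytic subvarieties).
* [KlinglerOtwinowskaUrbanik2023] B. Klingler, A. Otwinowska, D. Urbanik, Ann. Sci. ÉNS 56 (2023),
  §1.1.2, Prop. 2.1 (= BKU Lemma 3.6).
-/

noncomputable section

open CategoryTheory AlgebraicGeometry

namespace Literature.AlgebraicGeometry.Motives

/-- **The special subvarieties of a smooth projective family meeting an affine open of the base are
countably many** (Cattani–Deligne–Kaplan 1995 Thm. 1.1 / Cor. 1.2 in the form of Baldi–Klingler–Ullmo
2024 §3.4: the special subvarieties of a smooth irreducible complex quasi-projective `S` for a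
polarizable `ℤ`VHS are the irreducible components of the (algebraic) preimages under the period map of
the countably many special subvarieties of the Hodge variety `Γ\D` — Def. 3.3 — i.e., by Lemma 3.6,
the closed irreducible `Y` maximal among the closed irreducible `Z` with `G_Z = G_Y`; hence countably
many). On the tree's carriers: for a classical Betti–Hodge datum `B`, a smooth projective family
`f : 𝒳 ⟶ S` over a smooth irreducible `ℂ`-scheme `S`, a geometric VHS datum `D` of `Rⁱf_*ℚ` and an
affine open `U ⊆ S`, the set of `Y ⊆ S(ℂ)` with `D.IsSpecialSubvariety Y` (BKU Lemma 3.6 on complex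
points) meeting `U(ℂ)` is countable. Localised to an affine open because `S` is not assumed
quasi-compact (module docstring); for the honest reduction of "special in `S`, meeting `U`" to
"special in the quasi-projective `U`" one uses that generic Mumford–Tate groups are attained on dense
opens (André 1992 §5, BKU §3.2).
-- TODO(general form): BKU state this for any polarizable `ℤ`VHS on a smooth quasi-projective `S`
-- (no holomorphic VHS in the tree; only the geometric case `Rⁱf_*ℤ` is rendered).
[cite: BaldiKlinglerUllmo2024, Def. 3.3, §3.4 and Lemma 3.6]
[cite: CattaniDeligneKaplan1995JAMS, Thm. 1.1 and Cor. 1.2] [cite: Andre1992, §5]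
[file AlgebraicGeometry/Motives/SpecialSubvarietiesCountable] -/
def countable_specialSubvarieties_meeting_affineOpen : Prop :=
  ∀ (B : BettiHodgeData ℂ), B.IsClassical → ∀ [HodgeTensorFacts.{0, 0}]
    ⦃𝒳 S : SchemeOver ℂ⦄ (f : 𝒳 ⟶ S) (n i : ℕ) (D : GeometricVHSData B f n i)
    [∀ s, Module.Finite ℚ (D.V.fiber s)],
    IrreducibleSpace S.left → AlgebraicGeometry.Smooth S.hom →
    ∀ U : S.left.Opens, IsAffineOpen U →
      {Y : Set (ComplexPoints S) | D.IsSpecialSubvariety Y ∧ ∃ y ∈ Y, y.pt ∈ U}.Countable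

section Consequences

variable [HodgeTensorFacts.{0, 0}] {B : BettiHodgeData ℂ} {𝒳 S : SchemeOver ℂ} {f : 𝒳 ⟶ S}
  {n i : ℕ} (D : GeometricVHSData B f n i) [∀ s, Module.Finite ℚ (D.V.fiber s)]

/-- Sanity (no content at the empty affine open): no special subvariety meets `⊥`, so the counted
set is empty there — the fact carries content only for non-empty `U`. [folklore] -/
theorem specialSubvarieties_meeting_bot_eq_empty :
    {Y : Set (ComplexPoints S) | D.IsSpecialSubvariety Y ∧ ∃ y ∈ Y, y.pt ∈ (⊥ : S.left.Opens)} = ∅ :=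
  Set.eq_empty_of_forall_notMem fun Y hY => by
    obtain ⟨y, -, hy⟩ := hY.2
    exact hy

/-- **The special subvarieties through a given point are countably many** (given the fact): take an
affine chart `U ∋ s` of `S` (affine opens form a basis); every special `Y ∋ s` meets `U`.
[cite: BaldiKlinglerUllmo2024, Def. 3.3, §3.4 and Lemma 3.6] -/
theorem countable_specialSubvarieties_containing_of
    (h : countable_specialSubvarieties_meeting_affineOpen) (hB : B.IsClassical)
    (hirr : IrreducibleSpace S.left) (hsm : AlgebraicGeometry.Smooth S.hom) (s : ComplexPoints S) :
    {Y : Set (ComplexPoints S) | D.IsSpecialSubvariety Y ∧ s ∈ Y}.Countable := by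
  obtain ⟨_, ⟨U, hU, rfl⟩, hsU, -⟩ :=
    S.left.isBasis_affineOpens.exists_subset_of_mem_open (Set.mem_univ s.pt) isOpen_univ
  refine (h B hB f n i D hirr hsm U hU).mono fun Y hY => ?_
  exact ⟨hY.1, s, hY.2, hsU⟩

/-- **On a quasi-compact base the special subvarieties are countably many** (given the fact) — the
printed global statement of Baldi–Klingler–Ullmo §3.4 for smooth irreducible `S` of finite type:
cover `S` by finitely many affine opens; a special `Y` is non-empty (irreducible), so it meets one of
them. [cite: BaldiKlinglerUllmo2024, Def. 3.3 and §3.4] -/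
theorem countable_specialSubvarieties_of
    (h : countable_specialSubvarieties_meeting_affineOpen) (hB : B.IsClassical)
    (hirr : IrreducibleSpace S.left) (hsm : AlgebraicGeometry.Smooth S.hom) [CompactSpace S.left] :
    {Y : Set (ComplexPoints S) | D.IsSpecialSubvariety Y}.Countable := by
  -- a finite affine open cover of the quasi-compact scheme `S`
  obtain ⟨t, ht⟩ := isCompact_univ.elim_finite_subcover
    (fun U : S.left.affineOpens => ((U : S.left.Opens) : Set S.left)) (fun U => U.1.isOpen)
    (fun x _ => by
      obtain ⟨_, ⟨U, hU, rfl⟩, hxU, -⟩ :=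
        S.left.isBasis_affineOpens.exists_subset_of_mem_open (Set.mem_univ x) isOpen_univ
      exact Set.mem_iUnion.2 ⟨⟨U, hU⟩, hxU⟩)
  -- every special `Y` meets some member of the cover
  refine ((t.countable_toSet).biUnion fun U _ => h B hB f n i D hirr hsm U.1 U.2).mono ?_
  intro Y hY
  obtain ⟨P, hP⟩ := hY.1.2.nonempty
  have hx := ht (Set.mem_univ P.val.pt)
  simp only [Set.mem_iUnion] at hx
  obtain ⟨U, hUt, hPU⟩ := hx
  exact Set.mem_biUnion (Finset.mem_coe.2 hUt) ⟨hY, P.val, hP, hPU⟩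

end Consequences

/-! ### The printed form: the non-Hodge-generic locus is a countable union of strict subvarieties

Appended 2026-08-17 (line lead of the crux `PeriodDeficiency.QbarGenericIsHodgeGeneric`, reshape r5).
Baldi–Klingler–Ullmo state Cattani–Deligne–Kaplan's theorem as (Thm. 1.1 of the held text
`paper:arxiv-2107.08838`, p. 3): "Let `S` be a smooth connected complex quasi-projective algebraic
variety and `𝕍` be a polarizable `ℤ`VHS over `S`. Then `HL(S, 𝕍^⊗)` is a countable union of closed
irreducible algebraic subvarieties of `S`: the (strict) special subvarieties of `S` for `𝕍`", where
(§3.2, p. 9, for "`Y ⊂ S` a closed irreducible algebraic subvariety (possibly singular)") a point of `Y`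
is Hodge-generic in `Y` iff `MT(𝕍_s)` has maximal dimension on `Y`, and "the Hodge locus `HL(S, 𝕍^⊗)`
is also the subset of points of `S` which are not Hodge-generic in `S`". The named fact
`cdk1995_nonHodgeGenericLocus_countableCover` below renders exactly this COVER statement — for every
closed irreducible `Z` (through a resolution `Z̃ → Z`, Hironaka 1964, whose generic Mumford–Tate group
is `G_Z` by André 1992 §5), traced on an affine chart as in
`countable_specialSubvarieties_meeting_affineOpen` — rather than the COUNT of special subvarieties;
the count follows from the cover by a descent through the non-generic loci (Noetherian chains, finitely
many irreducible components meet an affine open) and the uncountability of `ℂ` (an irreducible variety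
is not a countable union of strict closed subvarieties), both PROVED in
`Summits/HodgeConjecture/HodgeConjecture/Theorems/PeriodDeficiencyQbarGenericIsHodgeGenericStub{CountableSpecialOfCover,IrreducibleSubsetOfCover,ExistsMaximalAvoidingCountable}.lean`,
so that `countable_specialSubvarieties_meeting_affineOpen` restricted to bases with bounded
Mumford–Tate ranks becomes a consequence of the fact below. -/

/-- **The non-Hodge-generic locus of a closed irreducible subvariety is, on an affine chart, covered
by countably many strict closed subvarieties** (Cattani–Deligne–Kaplan 1995, Thm. 1.1 / Cor. 1.2, in
the form of Baldi–Klingler–Ullmo 2024, Thm. 1.1: for a polarizable `ℤ`VHS `𝕍` on a smooth connected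
complex quasi-projective `S`, the Hodge locus `HL(S, 𝕍^⊗)` — the set of points which are not
Hodge-generic, i.e. where `dim MT(𝕍_s)` is not maximal, BKU §3.2 — is a countable union of strict
closed irreducible algebraic subvarieties of `S`). For a closed irreducible, possibly singular,
`Z ⊆ S` (the setting of BKU §3.2) one applies this to the pull-back of `𝕍` to a resolution
`Z̃ → Z ∩ U` (Hironaka 1964) over an affine chart `U`: its generic Mumford–Tate group is the generic
Mumford–Tate group `G_Z` of `Z` (André 1992, §5: `MT(𝕍_z) ⊆ G_Z` at every `z ∈ Z`, with equality off
a countable union of strict subvarieties), and the images in `Z` of the countably many strict closed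
subvarieties of `Z̃` forming `HL(Z̃, 𝕍^⊗)` are strict closed subvarieties of `Z` containing every
non-Hodge-generic point of `Z` over `U`. On the tree's carriers (as for
`countable_specialSubvarieties_meeting_affineOpen`): for a classical Betti–Hodge datum `B`, a smooth
projective family `f : 𝒳 ⟶ S` over a smooth irreducible `ℂ`-scheme `S`, a geometric VHS datum `D` of
`Rⁱf_*ℚ` (whose `D.mtRankAt z` is the honest `dim MT(Hⁱ(𝒳_z))`, pinned by `B.IsClassical`), an
affine open `U ⊆ S` and an irreducible Zariski-closed `Z ⊆ S(ℂ)` (`IsIrreducibleZariskiClosedOnPoints`)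
meeting `U(ℂ)`: there are Zariski-closed `W k ⊆ S(ℂ)` (`k ∈ ℕ`), none containing `Z`, such that every
`z ∈ Z` over `U` with `D.mtRankAt z < D.genericMTRank Z` lies in some `W k` (when no such `z` exists,
`W k = ∅` qualifies since `Z ≠ ∅`). Localised to an affine chart because `S` is not assumed
quasi-compact or separated (module docstring).
-- TODO(general form): BKU Thm. 1.1 is stated for every polarizable `ℤ`VHS on a smooth connected
-- quasi-projective `S` (no holomorphic VHS in the tree; only the geometric case `Rⁱf_*ℤ` is rendered,
-- and only through the pointwise Mumford–Tate ranks `VHSData.mtRankAt`).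
[cite: BaldiKlinglerUllmo2024, Thm. 1.1 and §3.2] [cite: CattaniDeligneKaplan1995JAMS, Thm. 1.1 and Cor. 1.2]
[cite: Andre1992, §5] [cite: Hironaka1964, Main Theorem I] -/
def cdk1995_nonHodgeGenericLocus_countableCover : Prop :=
  ∀ (B : BettiHodgeData ℂ), B.IsClassical → ∀ [HodgeTensorFacts.{0, 0}]
    ⦃𝒳 S : SchemeOver ℂ⦄ (f : 𝒳 ⟶ S) (n i : ℕ) (D : GeometricVHSData B f n i)
    [∀ s, Module.Finite ℚ (D.V.fiber s)],
    IrreducibleSpace S.left → AlgebraicGeometry.Smooth S.hom →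
    ∀ U : S.left.Opens, IsAffineOpen U →
    ∀ Z : Set (ComplexPoints S), IsIrreducibleZariskiClosedOnPoints S Z → (∃ z ∈ Z, z.pt ∈ U) →
      ∃ W : ℕ → Set (ComplexPoints S), (∀ k, IsZariskiClosedOnPoints S (W k) ∧ ¬ Z ⊆ W k) ∧
        ∀ z ∈ Z, z.pt ∈ U → D.mtRankAt z < D.genericMTRank Z → ∃ k, z ∈ W k

section CoverConsequences

variable [HodgeTensorFacts.{0, 0}] {B : BettiHodgeData ℂ} {𝒳 S : SchemeOver ℂ} {f : 𝒳 ⟶ S}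
  {n i : ℕ} (D : GeometricVHSData B f n i) [∀ s, Module.Finite ℚ (D.V.fiber s)]

/-- **Hodge-generic subvarieties need no cover**: if every point of `Z` over `U` is Hodge-generic in
`Z` (`D.mtRankAt z = D.genericMTRank Z`, e.g. `Z` a point), the conclusion of the fact holds with the
empty cover — the fact carries content only where the non-generic locus of `Z` meets `U`. [folklore] -/
theorem exists_cover_of_forall_not_lt {U : S.left.Opens} {Z : Set (ComplexPoints S)}
    (hZ : ∃ z ∈ Z, z.pt ∈ U) (hgen : ∀ z ∈ Z, z.pt ∈ U → ¬ D.mtRankAt z < D.genericMTRank Z) :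
    ∃ W : ℕ → Set (ComplexPoints S), (∀ k, IsZariskiClosedOnPoints S (W k) ∧ ¬ Z ⊆ W k) ∧
      ∀ z ∈ Z, z.pt ∈ U → D.mtRankAt z < D.genericMTRank Z → ∃ k, z ∈ W k := by
  obtain ⟨z₀, hz₀, -⟩ := hZ
  exact ⟨fun _ => ∅, fun _ => ⟨isZariskiClosedOnPoints_empty S, fun h => h hz₀⟩,
    fun z hz hzU hlt => (hgen z hz hzU hlt).elim⟩

/-- **The non-generic points of `Z` over `U` lie in the union of the cover** (the fact, unfolded at
one `Z`). [cite: BaldiKlinglerUllmo2024, Thm. 1.1 and §3.2] -/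
theorem nonGenericLocus_subset_iUnion_of (h : cdk1995_nonHodgeGenericLocus_countableCover)
    (hB : B.IsClassical) (hirr : IrreducibleSpace S.left) (hsm : AlgebraicGeometry.Smooth S.hom)
    {U : S.left.Opens} (hU : IsAffineOpen U) {Z : Set (ComplexPoints S)}
    (hZ : IsIrreducibleZariskiClosedOnPoints S Z) (hZU : ∃ z ∈ Z, z.pt ∈ U) :
    ∃ W : ℕ → Set (ComplexPoints S), (∀ k, IsZariskiClosedOnPoints S (W k) ∧ ¬ Z ⊆ W k) ∧
      {z | z ∈ Z ∧ z.pt ∈ U ∧ D.mtRankAt z < D.genericMTRank Z} ⊆ ⋃ k, W k := by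
  obtain ⟨W, hW, hcov⟩ := h B hB f n i D hirr hsm U hU Z hZ hZU
  refine ⟨W, hW, fun z hz => ?_⟩
  obtain ⟨k, hk⟩ := hcov z hz.1 hz.2.1 hz.2.2
  exact Set.mem_iUnion.2 ⟨k, hk⟩

end CoverConsequences

end Literature.AlgebraicGeometry.Motives

end
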